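import Literature.NumberTheory.Transcendental.AperyTable
import HarnessLib

/-!
# Apéry's tables `q` and `p`: positivity, Casoratians, growth, integrality

Continuation of `AperyTable.lean` (Apéry 1981 / Rajkumar 2012, arXiv:1212.5881) for the two
concrete tables `qT = table 1` and `pT = table H₃`:

* **positivity / monotonicity** (Rajkumar, proof of Prop. 3, from (cond4)
  `f(i,j) - f(0,j) > g(i,j) - g(0,j)`): `1 ≤ q_{i,j}`, rows and columns of `q` are
  non-decreasing, and `q_{i+1,j} ≥ j+1` (`qT_one`: `q_{1,j} = 2j² + 2j + 1`);
* **Casoratians** (Rajkumar (prop3-1), (prop3-2)):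
  `p_{i,j+1} q_{i,j} - p_{i,j} q_{i,j+1} = (j+1)⁻³` and
  `p_{i+1,j} q_{i,j} - p_{i,j} q_{i+1,j} = (i+1)⁻³`;
* **growth of the Apéry numbers** `q_{n,n}`: `33 q_{n,n} ≤ q_{n+1,n+1}` for `n ≥ 62`, hence
  `33^m q_{62,62} ≤ q_{62+m,62+m}` — an elementary bootstrap on the `2 × 2` system
  `q_{n+1,n+1} = 6 q_{n,n+1} - q_{n,n}`, `(n+1)³ q_{n,n+1} = (6n³+9n²+5n+1) q_{n,n} - n³ q_{n-1,n}`
  (Rajkumar's matrix `A_n`, whose limit has eigenvalues `17 ± 12√2`; `33 < 17 + 12√2 ≈ 33.97`),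
  replacing the Poincaré–Perron theorem used in [Rajkumar2012, §3 Prop. 4];
* **integrality** (Rajkumar Prop. 2): `q_{i,j} ∈ ℤ` and `lcm(1,…,N)³ p_{i,j} ∈ ℤ` for
  `i, j ≤ N`.

## References
* [Rajkumar2012] K. Rajkumar, arXiv:1212.5881, §2 Prop. 2, 3; §3.
* [Apery1981] R. Apéry, Interpolation de fractions continues…, Bull. Sect. Sci. C.T.H.S. III (1981).
-/

open Finset

namespace Literature.NumberTheory.Transcendental

namespace Apery

/-! ### Positivity and monotonicity of `q` -/

/-- `1 ≤ q_{i,j}` and `q_{i,j} ≤ q_{i,j+1}`: rows of `q` are non-decreasing and bounded below by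
`1` (induction on the rows; the step is (cond4), in the form
`i³(q_{i,j+1} - q_{i,j}) = (i³+2i²j+2ij²)(q_{i-1,j+1} - q_{i-1,j}) + 4i²j q_{i-1,j} ≥ 0`).
[cite: Rajkumar2012, §2 Prop. 3 (proof, (cond4))] -/
theorem one_le_qT_and_mono : ∀ i j : ℕ, 1 ≤ qT i j ∧ qT i j ≤ qT i (j + 1) := by
  intro i
  induction i with
  | zero => intro j; simp
  | succ i ih =>
    have hmono : ∀ j, qT (i + 1) j ≤ qT (i + 1) (j + 1) := by
      intro j
      have h1 := rec_fst (fun _ => (1 : ℚ)) i j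
      have h2 := rec_snd boundary_one i j
      have hq0 : 0 ≤ qT i j := le_trans zero_le_one (ih j).1
      have hq1 : qT i j ≤ qT i (j + 1) := (ih j).2
      have key : ((i : ℚ) + 1) ^ 3 * (qT (i + 1) (j + 1) - qT (i + 1) j) =
          (((i : ℚ) + 1) ^ 3 + 2 * ((i : ℚ) + 1) ^ 2 * ((j : ℚ) + 1)
              + 2 * ((i : ℚ) + 1) * ((j : ℚ) + 1) ^ 2) * (qT i (j + 1) - qT i j)
            + 4 * ((i : ℚ) + 1) ^ 2 * ((j : ℚ) + 1) * qT i j := by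
        unfold qT at *
        unfold f g at *
        linear_combination h1 - h2
      have hpos : (0 : ℚ) < ((i : ℚ) + 1) ^ 3 := by positivity
      have hrhs : 0 ≤ ((i : ℚ) + 1) ^ 3 * (qT (i + 1) (j + 1) - qT (i + 1) j) := by
        rw [key]
        have : 0 ≤ qT i (j + 1) - qT i j := sub_nonneg.mpr hq1
        positivity
      nlinarith
    intro j
    refine ⟨?_, hmono j⟩
    induction j with
    | zero => simp
    | succ j ihj => exact ihj.trans (hmono j)

/-- `1 ≤ q_{i,j}`. [cite: Rajkumar2012, §2 Prop. 3 (proof)] -/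
theorem one_le_qT (i j : ℕ) : 1 ≤ qT i j := (one_le_qT_and_mono i j).1

/-- `0 < q_{i,j}`. [cite: Rajkumar2012, §2 Prop. 3 (proof)] -/
theorem qT_pos (i j : ℕ) : 0 < qT i j := lt_of_lt_of_le zero_lt_one (one_le_qT i j)

/-- `q_{i,j} ≤ q_{i,j+1}`. [cite: Rajkumar2012, §2 Prop. 3 (proof)] -/
theorem qT_le_succ_right (i j : ℕ) : qT i j ≤ qT i (j + 1) := (one_le_qT_and_mono i j).2

/-- Each row `j ↦ q_{i,j}` is monotone. [cite: Rajkumar2012, §2 Prop. 3 (proof)] -/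
theorem qT_mono_right (i : ℕ) : Monotone (qT i) :=
  monotone_nat_of_le_succ (qT_le_succ_right i)

/-- Column monotonicity `q_{i,j} ≤ q_{i+1,j}` (from the first line of (rec1):
`i³ q_{i,j} ≥ (f(i,j) - j³) q_{i-1,j} ≥ i³ q_{i-1,j}`). [cite: Rajkumar2012, §2 Prop. 3 (proof)] -/
theorem qT_le_succ_left (i j : ℕ) : qT i j ≤ qT (i + 1) j := by
  cases j with
  | zero => simp
  | succ j =>
    have h1 := rec_fst (fun _ => (1 : ℚ)) i j
    have hq0 : 0 ≤ qT i j := (qT_pos i j).le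
    have hq1 : qT i j ≤ qT i (j + 1) := qT_le_succ_right i j
    have hq2 : 0 ≤ qT i (j + 1) := (qT_pos i (j + 1)).le
    have key : ((i : ℚ) + 1) ^ 3 * (qT (i + 1) (j + 1) - qT i (j + 1)) =
        (2 * ((i : ℚ) + 1) ^ 2 * ((j : ℚ) + 1) + 2 * ((i : ℚ) + 1) * ((j : ℚ) + 1) ^ 2)
            * qT i (j + 1) + ((j : ℚ) + 1) ^ 3 * (qT i (j + 1) - qT i j) := by
      unfold qT at *
      unfold f at h1
      linear_combination h1
    have hpos : (0 : ℚ) < ((i : ℚ) + 1) ^ 3 := by positivity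
    have hrhs : 0 ≤ ((i : ℚ) + 1) ^ 3 * (qT (i + 1) (j + 1) - qT i (j + 1)) := by
      rw [key]
      have : 0 ≤ qT i (j + 1) - qT i j := sub_nonneg.mpr hq1
      positivity
    nlinarith

/-- Row `1` in closed form: `q_{1,j} = 2j² + 2j + 1 = P(0,j)`. [cite: Rajkumar2012, §4 (q_{i,1} = P(0,i))] -/
theorem qT_one (j : ℕ) : qT 1 j = 2 * (j : ℚ) ^ 2 + 2 * j + 1 := by
  cases j with
  | zero => simp
  | succ j =>
    have h1 := rec_fst (fun _ => (1 : ℚ)) 0 j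
    unfold qT
    unfold f at h1
    simp only [Nat.cast_zero, zero_add, one_pow, one_mul, table_zero_left, mul_one] at h1
    rw [h1]
    push_cast
    ring

/-- `j + 1 ≤ q_{i+1,j}`: the rows `i ≥ 1` grow at least linearly (so `q_{i,j} q_{i-1,j} → ∞`
along every row `i ≥ 1`, as needed in Prop. 3). [cite: Rajkumar2012, §2 Prop. 3 (proof)] -/
theorem succ_le_qT_succ (i j : ℕ) : (j : ℚ) + 1 ≤ qT (i + 1) j := by
  induction i with
  | zero =>
    rw [qT_one]
    nlinarith [sq_nonneg (j : ℚ)]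
  | succ i ih => exact ih.trans (qT_le_succ_left (i + 1) j)

/-! ### Casoratians -/

/-- **Row Casoratian** `δ^{row}`: `p_{i,j+1} q_{i,j} - p_{i,j} q_{i,j+1} = 1/(j+1)³` for every row `i`
(Rajkumar (prop3-1)/(prop3-2): `δ^{row}_{i+1,j} = δ^{row}_{i,j} = … = δ^{row}_{1,j} = j⁻³`, via the
second lines of (rec1) and (rec3)). [cite: Rajkumar2012, §2 Prop. 3 (prop3-1), (prop3-2)] -/
theorem casoratian_row (i j : ℕ) :
    pT i (j + 1) * qT i j - pT i j * qT i (j + 1) = 1 / ((j : ℚ) + 1) ^ 3 := by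
  induction i generalizing j with
  | zero => simp [H3_succ]
  | succ i ih =>
    have e4p := rec3_bot boundary_H3 i j
    have e4q := rec3_bot boundary_one i j
    have e2p := rec_snd boundary_H3 i j
    have e2q := rec_snd boundary_one i j
    have hQ : ((j : ℚ) + 1) ^ 3 ≠ 0 := by positivity
    apply mul_left_cancel₀ hQ
    have key : ((j : ℚ) + 1) ^ 3 * (pT (i + 1) (j + 1) * qT (i + 1) j
        - pT (i + 1) j * qT (i + 1) (j + 1)) =
        ((j : ℚ) + 1) ^ 3 * (pT i (j + 1) * qT i j - pT i j * qT i (j + 1)) := by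
      unfold pT qT at *
      linear_combination (-(table (fun _ => (1 : ℚ)) (i + 1) j)) * e4p
        + (table H3 (i + 1) j) * e4q + (table (fun _ => (1 : ℚ)) i j) * e2p
        - (table H3 i j) * e2q
    rw [key, ih j]

/-- **Column Casoratian** `δ^{col}_{i+1,j+1} = (i+1)⁻³`: `p_{i+1,j} q_{i,j} - p_{i,j} q_{i+1,j} = 1/(i+1)³`
(so `r_{i+1,j} - r_{i,j} = 1/((i+1)³ q_{i+1,j} q_{i,j})`). [cite: Rajkumar2012, §2 Prop. 3 (proof)] -/
theorem casoratian_col (i j : ℕ) :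
    pT (i + 1) j * qT i j - pT i j * qT (i + 1) j = 1 / ((i : ℚ) + 1) ^ 3 := by
  have e2p := rec_snd boundary_H3 i j
  have e2q := rec_snd boundary_one i j
  have hc := casoratian_row i j
  have hP : ((i : ℚ) + 1) ^ 3 ≠ 0 := by positivity
  apply mul_left_cancel₀ hP
  rw [mul_one_div_cancel hP]
  have key : ((i : ℚ) + 1) ^ 3 * (pT (i + 1) j * qT i j - pT i j * qT (i + 1) j) =
      ((j : ℚ) + 1) ^ 3 * (pT i (j + 1) * qT i j - pT i j * qT i (j + 1)) := by
    unfold pT qT at *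
    linear_combination (table (fun _ => (1 : ℚ)) i j) * e2p - (table H3 i j) * e2q
  rw [key, hc, mul_one_div_cancel (by positivity)]

/-! ### Growth along the diagonal -/

/-- `5 q_{k,k+1} ≤ q_{k+1,k+1}` (from `q_{k+1,k+1} = 6 q_{k,k+1} - q_{k,k}` and `q_{k,k} ≤ q_{k,k+1}`).
[cite: Rajkumar2012, §3 (A_n)] -/
theorem five_mul_qT_le (k : ℕ) : 5 * qT k (k + 1) ≤ qT (k + 1) (k + 1) := by
  have h := diag_succ (r := fun _ => (1 : ℚ)) k
  have hm := qT_le_succ_right k k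
  unfold qT at *
  linarith

/-- **Growth of the Apéry numbers**: `33 q_{k+1,k+1} ≤ q_{k+2,k+2}` for `k ≥ 61`. With
`K = k+1`: `(K+1)³ q_{K+1,K+1} = 6(6K³+9K²+5K+1) q_{K,K} - 6K³ q_{K-1,K} - (K+1)³ q_{K,K}` and
`q_{K-1,K} ≤ q_{K,K}/5`, and `6(6K³+9K²+5K+1) - 34(K+1)³ - (6/5)K³ ≥ 0` for `K ≥ 62`. This
elementary bootstrap replaces the Poincaré–Perron asymptotics `q_{n,n} = (17+12√2)^{n(1+o(1))}`.
[cite: Rajkumar2012, §3 (A_n), Prop. 4] -/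
theorem qT_diag_growth {k : ℕ} (hk : 61 ≤ k) : 33 * qT (k + 1) (k + 1) ≤ qT (k + 2) (k + 2) := by
  have h1 := diag_succ (r := fun _ => (1 : ℚ)) (k + 1)
  have h2 := super_diag boundary_one k
  have hA := five_mul_qT_le k
  have hB : 0 ≤ qT (k + 1) (k + 1) := (qT_pos _ _).le
  have hA0 : 0 ≤ qT k (k + 1) := (qT_pos _ _).le
  have hk' : (61 : ℚ) ≤ k := by exact_mod_cast hk
  rw [show k + 1 + 1 = k + 2 from rfl] at h1
  unfold qT at *
  set A := table (fun _ => (1 : ℚ)) k (k + 1)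
  set B := table (fun _ => (1 : ℚ)) (k + 1) (k + 1)
  set C := table (fun _ => (1 : ℚ)) (k + 1) (k + 2)
  set D := table (fun _ => (1 : ℚ)) (k + 2) (k + 2)
  have key : ((k : ℚ) + 2) ^ 3 * (D - 33 * B) =
      (6 * (6 * ((k : ℚ) + 1) ^ 3 + 9 * ((k : ℚ) + 1) ^ 2 + 5 * ((k : ℚ) + 1) + 1)
        - 34 * ((k : ℚ) + 2) ^ 3) * B - 6 * ((k : ℚ) + 1) ^ 3 * A := by
    linear_combination ((k : ℚ) + 2) ^ 3 * h1 + 6 * h2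
  have hpoly : 0 ≤ 4 * ((k : ℚ) + 1) ^ 3 - 240 * ((k : ℚ) + 1) ^ 2
      - 360 * ((k : ℚ) + 1) - 140 := by
    nlinarith [mul_nonneg (mul_nonneg (sub_nonneg.mpr hk') (sub_nonneg.mpr hk'))
      (sub_nonneg.mpr hk'), mul_nonneg (sub_nonneg.mpr hk') (sub_nonneg.mpr hk')]
  have hrhs : 0 ≤ ((k : ℚ) + 2) ^ 3 * (D - 33 * B) := by
    rw [key]
    nlinarith [mul_nonneg hpoly hB]
  have hpos : (0 : ℚ) < ((k : ℚ) + 2) ^ 3 := by positivity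
  nlinarith

/-- `33^m q_{62,62} ≤ q_{62+m,62+m}`: the Apéry numbers grow at least like `33ⁿ`.
[cite: Rajkumar2012, §3 (eps_decay)] -/
theorem pow_mul_qT_le (m : ℕ) : 33 ^ m * qT 62 62 ≤ qT (62 + m) (62 + m) := by
  induction m with
  | zero => simp
  | succ m ih =>
    have h := qT_diag_growth (k := 61 + m) (by omega)
    have e1 : 61 + m + 1 = 62 + m := by omega
    have e2 : 61 + m + 2 = 62 + (m + 1) := by omega
    rw [e1, e2] at h
    calc (33 : ℚ) ^ (m + 1) * qT 62 62 = 33 * (33 ^ m * qT 62 62) := by ring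
      _ ≤ 33 * qT (62 + m) (62 + m) := by gcongr
      _ ≤ qT (62 + (m + 1)) (62 + (m + 1)) := h

/-! ### Integrality -/

/-- **Rajkumar's Proposition 2 for `q`**: every `q_{i,j}` is an integer. [cite: Rajkumar2012, §2 Prop. 2] -/
theorem qT_isInt (i j : ℕ) : ∃ m : ℤ, qT i j = m := by
  induction i generalizing j with
  | zero => exact ⟨1, by simp⟩
  | succ i ih =>
    induction j with
    | zero => exact ⟨1, by simp⟩
    | succ j ihj =>
      obtain ⟨x, y, z, h⟩ := exists_int_combination boundary_one i j
      obtain ⟨m1, hm1⟩ := ihj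
      obtain ⟨m2, hm2⟩ := ih (j + 1)
      obtain ⟨m3, hm3⟩ := ih j
      refine ⟨x * m1 + y * m2 + z * m3, ?_⟩
      unfold qT at *
      rw [h, hm1, hm2, hm3]
      push_cast
      ring

/-- `lcm(1,…,N)³ H₃(j) ∈ ℤ` for `j ≤ N` (the boundary values in Prop. 2). [cite: Rajkumar2012, §2 Prop. 2] -/
theorem lcmUpto_cube_mul_H3_isInt {N j : ℕ} (hj : j ≤ N) :
    ∃ m : ℤ, (Nat.lcmUpto N : ℚ) ^ 3 * H3 j = m := by
  induction j with
  | zero => exact ⟨0, by simp [H3_zero]⟩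
  | succ j ih =>
    obtain ⟨m, hm⟩ := ih (Nat.le_of_succ_le hj)
    have hdvd : j + 1 ∣ Nat.lcmUpto N :=
      Finset.dvd_lcm (Finset.mem_Icc.mpr ⟨Nat.succ_pos j, hj⟩)
    obtain ⟨c, hc⟩ := hdvd
    refine ⟨m + (c : ℤ) ^ 3, ?_⟩
    rw [H3_succ, mul_add, hm, hc]
    push_cast
    field_simp

/-- **Rajkumar's Proposition 2 for `p`**: `lcm(1,…,N)³ p_{i,j} ∈ ℤ` for `i, j ≤ N`
(`d_{max(i,j)}³ p_{i,j} ∈ ℤ`). [cite: Rajkumar2012, §2 Prop. 2] -/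
theorem lcmUpto_cube_mul_pT_isInt (N : ℕ) :
    ∀ i j : ℕ, i ≤ N → j ≤ N → ∃ m : ℤ, (Nat.lcmUpto N : ℚ) ^ 3 * pT i j = m := by
  intro i
  induction i with
  | zero =>
    intro j _ hj
    simpa using lcmUpto_cube_mul_H3_isInt hj
  | succ i ih =>
    intro j hi hj
    induction j with
    | zero => simpa using lcmUpto_cube_mul_H3_isInt hi
    | succ j ihj =>
      obtain ⟨x, y, z, h⟩ := exists_int_combination boundary_H3 i j
      obtain ⟨m1, hm1⟩ := ihj (Nat.le_of_succ_le hj)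
      obtain ⟨m2, hm2⟩ := ih (j + 1) (Nat.le_of_succ_le hi) hj
      obtain ⟨m3, hm3⟩ := ih j (Nat.le_of_succ_le hi) (Nat.le_of_succ_le hj)
      refine ⟨x * m1 + y * m2 + z * m3, ?_⟩
      unfold pT at *
      rw [h]
      push_cast
      linear_combination (x : ℚ) * hm1 + (y : ℚ) * hm2 + (z : ℚ) * hm3

end Apery

end Literature.NumberTheory.Transcendental
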